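import Summits.Ventures.GridStability.Models.NE39SP39DroopQVHessData

/-!
# GridStability/Models/NE39SP39DroopQVHessBlocks1 — chunked closeness of the Hessian twin for «DROOPQV-NE39SP39», row ranges `0–5, 48–53, 54–59, 108–113`

Cell `gridfusion` (seat gridfusion-model-8 (g4); item (F)). Each theorem is ONE kernel decide of lit-5's `PSD.closeRangeN 117 S s e lo 6 hessRows (gramRowsLT 117 hessLt)`:
for the six rows `lo … lo+5` it EVALUATES `G_ij = (L̃L̃ᵀ)_ij` (ragged integer dots, mirrored) and `Q_ij` (the ℚ-twin expression `hessQfun`) and checks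
`|S·Q_ij − (G_ij + s·[i = j])| ≤ e` with `S = 4³⁰ = 1152921504606846976`, `s = 8915039122860`, `e = 76196915580` ([cite: Rump1999VerifiedLargeSystems, §4 Algorithm 4.1 step 7]).
THREE COLUMNS. CERTIFIED (kernel): closeness facts about data. No parameter claim; no stability sentence.
-/

noncomputable section

open Literature.Computation.Certificates

namespace Summit.Ventures.GridStability.Models

namespace NE39SP39

open DeflRows

/-- Closeness on rows `0 … 5` (range `0` of width 6). [folklore] -/
theorem hessRange0 : PSD.closeRangeN 117 1152921504606846976 8915039122860 76196915580 (0 * 6) 6 hessRows (gramRowsLT 117 hessLt) = true := by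
  decide +kernel

/-- Closeness on rows `48 … 53` (range `8` of width 6). [folklore] -/
theorem hessRange8 : PSD.closeRangeN 117 1152921504606846976 8915039122860 76196915580 (8 * 6) 6 hessRows (gramRowsLT 117 hessLt) = true := by
  decide +kernel

/-- Closeness on rows `54 … 59` (range `9` of width 6). [folklore] -/
theorem hessRange9 : PSD.closeRangeN 117 1152921504606846976 8915039122860 76196915580 (9 * 6) 6 hessRows (gramRowsLT 117 hessLt) = true := by
  decide +kernel

/-- Closeness on rows `108 … 113` (range `18` of width 6). [folklore] -/
theorem hessRange18 : PSD.closeRangeN 117 1152921504606846976 8915039122860 76196915580 (18 * 6) 6 hessRows (gramRowsLT 117 hessLt) = true := by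
  decide +kernel

end NE39SP39

end Summit.Ventures.GridStability.Models

end
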